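import Summits.AtomisticToContinuum.FouriersLaw.Theorems.BondHeatUncertaintyExtensiveSnapshotIrreversibilityEnergyWindowStatements

/-!
# Crux `ExtensiveSnapshotIrreversibility` (stmt-AtomisticToContinuum-9121), fixed-`N` half `K_fix`:
the regularity atoms of record `(R)` imply the energy-window statement `(W)`, hence `K_fix`

Part 4/4 of the energy-window reduction (imports `…EnergyWindowStatements`: `K_fix`, `(W)`,
`(W) ⟹ K_fix`).

  `ClausiusBudget.stub_oddLogDensity_of_regularity` (S1g), VERBATIM, and
  `energyWindowControl_of_logDensityRegularity : LogDensityRegularity → EnergyWindowControl`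
  ((R2) ⇒ (T1), (T2o); (R3) ⇒ (B1w) with `a = 0`; (R2)+(R3)+(R4) ⇒ (B2) with `g₀ = h₀` by dominated
  convergence in `L²(μ_T)`).


So `K_fix ⟸ (W) ⟸ (R)`; the converse probes fail (see the probes of this node).  What `(W)` DROPS
relative to `(R)` is visible: the `O(δ)`-precise two-sided control of `log ρ_δ − log ρ_T` at ALL
energies ((R3)) is replaced by the `δ`-uniform crude odd bound (T2o) plus a one-sided polynomial lower
bound (B1w), because the Lyapunov tail beyond `E_δ = (6/θ) log(1/|δ|)` has mass `O(|δ|³)`.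
No new objects; one `Prop` abbreviation of an existing statement text.
References: see `…EnergyWindowTree`.
-/

noncomputable section

namespace Summit.AtomisticToContinuum.FouriersLaw.Theorems.ExtensiveSnapshotIrreversibility.EnergyWindow

open MeasureTheory Filter Topology InformationTheory Real
open scoped ENNReal NNReal
open Literature.MathematicalPhysics.KineticTheory.HeatConduction
-- landing revision (as in the landed `…EnergyWindowTree` / `…EnergyWindow`): the seat namespace `Tree` of re-proved tree lemmas is gone;
-- the originals are opened instead.
open Summit.AtomisticToContinuum.FouriersLaw.Theorems.ExtensiveSnapshotIrreversibility.Negative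
open Summit.AtomisticToContinuum.FouriersLaw.Theorems.ExtensiveSnapshotIrreversibility.ClausiusBudget.OddLogDensity

variable {N : ℕ}

/-! ## 4. The dictionary `(R) ⟹ (W)`: the regularity atoms of record imply the energy-window statement -/

/-- **`(R)` = `LogDensityRegularity`**, verbatim the hypothesis of
`ClausiusBudget.stub_oddLogDensity_of_regularity` (S1g): for the family `μ`, `T > 0`, `N ≥ 2` there
are `δ₀ > 0`, `0 < η < 1/(4T)`, `C`, `k`, measurable `φ_δ`, measurable `h₀` with
(R1) `μ_{N,T+δ/2,T−δ/2} = μ_T · e^{φ_δ}` for `0 < |δ| < δ₀`, (R2) `|φ_δ| ≤ η(1 + H)`,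
(R3) `|φ_δ| ≤ C|δ|(1 + H)^k`, (R4) `φ_δ/δ → h₀` pointwise. [route statement · this cell; NOT a literature fact] -/
def LogDensityRegularity : Prop :=
  ∀ ω₂ lam β γ : ℝ, 0 < ω₂ → 0 < lam → 0 < β → 0 < γ →
    (∀ (N : ℕ) (T_L T_R : ℝ), 0 < T_L → 0 < T_R → ∀ μ ν : Measure (PhaseSpace N),
      (pinnedChain ω₂ lam β γ).IsSteadyState N T_L T_R μ →
      (pinnedChain ω₂ lam β γ).IsSteadyState N T_L T_R ν → μ = ν) →
    ∀ μ : (N : ℕ) → ℝ → ℝ → Measure (PhaseSpace N),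
      (∀ (N : ℕ) (T_L T_R : ℝ), 0 < T_L → 0 < T_R →
        (pinnedChain ω₂ lam β γ).IsSteadyState N T_L T_R (μ N T_L T_R)) →
      ∀ T : ℝ, 0 < T → ∀ N : ℕ, 2 ≤ N →
        ∃ δ₀ η C : ℝ, ∃ k : ℕ, 0 < δ₀ ∧ 0 < η ∧ η < 1 / (4 * T) ∧
        ∃ φ : ℝ → PhaseSpace N → ℝ, ∃ h₀ : PhaseSpace N → ℝ,
          (∀ δ : ℝ, Measurable (φ δ)) ∧ Measurable h₀ ∧
          (∀ δ : ℝ, δ ≠ 0 → |δ| < δ₀ →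
            μ N (T + δ / 2) (T - δ / 2) =
              ((pinnedChain ω₂ lam β γ).gibbsMeasure N T).withDensity
                (fun x => ENNReal.ofReal (Real.exp (φ δ x)))) ∧
          (∀ δ : ℝ, |δ| < δ₀ → ∀ x : PhaseSpace N,
            |φ δ x| ≤ η * (1 + (pinnedChain ω₂ lam β γ).hamiltonian N x)) ∧
          (∀ δ : ℝ, |δ| < δ₀ → ∀ x : PhaseSpace N,
            |φ δ x| ≤ C * |δ| * (1 + (pinnedChain ω₂ lam β γ).hamiltonian N x) ^ k) ∧
          (∀ x : PhaseSpace N, Tendsto (fun δ : ℝ => φ δ x / δ) (𝓝[≠] (0 : ℝ)) (𝓝 (h₀ x)))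

-- `abs_exp_sub_one_le_mul` of the seat file (|e^x − 1| ≤ |x| e^{|x|}) IS the tree's
-- `ClausiusBudget.OddLogDensity.abs_exp_sub_one_le_abs_mul_exp_abs` (…OddLogDensityOfRegularityAux1, opened above); deleted and cited (dedup gate p850165).

/-- If `u_δ → 0` and `u_δ/δ → A` along `δ → 0`, `δ ≠ 0`, then `(e^{u_δ} − 1)/δ → A`
(`|e^u − 1 − u| ≤ u²` for `|u| ≤ 1`). [folklore] -/
theorem tendsto_exp_sub_one_div {u : ℝ → ℝ} {A : ℝ} (hu : Tendsto u (𝓝[≠] (0 : ℝ)) (𝓝 0))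
    (hA : Tendsto (fun δ => u δ / δ) (𝓝[≠] (0 : ℝ)) (𝓝 A)) :
    Tendsto (fun δ => (exp (u δ) - 1) / δ) (𝓝[≠] (0 : ℝ)) (𝓝 A) := by
  have h1 : ∀ᶠ δ in 𝓝[≠] (0 : ℝ), |u δ| ≤ 1 := by
    have h := hu.abs
    rw [abs_zero] at h
    exact h.eventually_le_const (by norm_num)
  have hprod : Tendsto (fun δ => |u δ / δ| * |u δ|) (𝓝[≠] (0 : ℝ)) (𝓝 0) := by
    have h := hA.abs.mul hu.abs
    rw [abs_zero, mul_zero] at h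
    exact h
  have hdiff : Tendsto (fun δ => (exp (u δ) - 1) / δ - u δ / δ) (𝓝[≠] (0 : ℝ)) (𝓝 0) := by
    refine squeeze_zero_norm' ?_ hprod
    filter_upwards [h1, self_mem_nhdsWithin] with δ hδ1 hδ
    have h2 := Real.abs_exp_sub_one_sub_id_le hδ1
    rw [Real.norm_eq_abs, ← sub_div, abs_div, abs_div]
    calc |exp (u δ) - 1 - u δ| / |δ| ≤ (u δ) ^ 2 / |δ| := div_le_div_of_nonneg_right h2 (abs_nonneg _)
      _ = |u δ| / |δ| * |u δ| := by rw [← sq_abs]; ring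
  have h := hdiff.add hA
  rw [zero_add] at h
  exact h.congr' (Eventually.of_forall fun δ => by ring)

/-- `(1 + H)^n e^{sH} ∈ L¹(μ_T)` for the pinned chain and `s < 1/T`
(cf. `ClausiusBudget.OddLogDensity.integrable_one_add_pow_mul_exp_gibbs`). [folklore] -/
theorem integrable_one_add_pow_mul_exp_gibbs {ω₂ lam β : ℝ} (hω : 0 < ω₂) (hl : 0 ≤ lam) (hβ : 0 ≤ β)
    (γ : ℝ) (N n : ℕ) {T s : ℝ} (hT : 0 < T) (hs : s < 1 / T) :
    Integrable (fun x => (1 + (pinnedChain ω₂ lam β γ).hamiltonian N x) ^ n *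
        exp (s * (pinnedChain ω₂ lam β γ).hamiltonian N x)) ((pinnedChain ω₂ lam β γ).gibbsMeasure N T) := by
  have hr : 0 < (1 / T - s) / 2 := by linarith
  have hrs : (1 / T - s) / 2 + s < 1 / T := by linarith
  have hint := pinnedChain_integrable_exp_mul_hamiltonian_gibbsMeasure hω hl hβ γ N hT hrs
  have hH0 := pinnedChain_hamiltonian_nonneg hω.le hl hβ γ N
  have hHm : Measurable ((pinnedChain ω₂ lam β γ).hamiltonian N) :=
    (pinnedChain_continuous_hamiltonian ω₂ lam β γ N).measurable
  refine (hint.const_mul (n.factorial * exp ((1 / T - s) / 2) / ((1 / T - s) / 2) ^ n)).mono'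
    (((measurable_const.add hHm).pow_const n).mul (hHm.const_mul s).exp).aestronglyMeasurable
    (ae_of_all _ fun x => ?_)
  rw [Real.norm_eq_abs, abs_of_nonneg (by have := hH0 x; positivity)]
  calc (1 + (pinnedChain ω₂ lam β γ).hamiltonian N x) ^ n * exp (s * (pinnedChain ω₂ lam β γ).hamiltonian N x)
      ≤ (n.factorial * exp ((1 / T - s) / 2) / ((1 / T - s) / 2) ^ n) *
          exp ((1 / T - s) / 2 * (pinnedChain ω₂ lam β γ).hamiltonian N x) *
          exp (s * (pinnedChain ω₂ lam β γ).hamiltonian N x) :=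
        mul_le_mul_of_nonneg_right (one_add_pow_le_factorial_mul_exp n (hH0 x) hr) (exp_pos _).le
    _ = (n.factorial * exp ((1 / T - s) / 2) / ((1 / T - s) / 2) ^ n) *
          exp (((1 / T - s) / 2 + s) * (pinnedChain ω₂ lam β γ).hamiltonian N x) := by
        rw [add_mul, exp_add]
        ring

/-- **`(R) ⟹ (W)`.**  The regularity atoms of record imply the energy-window statement, with
`θ = (1/T − η)/2`, `a = 0`, `C₁ = e^{η} ∫ e^{(θ+η)H} dμ_T`, `C₂ = 2η`, `k ↦ 1`, `C₃ = C`, `m = k`,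
`g₀ = h₀` and `δ₀ ↦ min δ₀ T`: (R2) ⇒ (T1) and (T2o); (R3) ⇒ (B1w) (`1 + φ ≤ e^{φ}`);
(R2)+(R3)+(R4) ⇒ (B2) (dominated convergence in `L²(μ_T)` with `|e^{φ} − 1| ≤ |φ| e^{|φ|}`,
`tendsto_exp_sub_one_div`).  Note what is NOT used: no `O(δ)`-precision on the ODD part — the seam
needs only the crude (T2o). [folklore] -/
theorem energyWindowControl_of_logDensityRegularity (hR : LogDensityRegularity) : EnergyWindowControl := by
  intro ω₂ lam β γ hω₂ hlam hβ hγ hU μ hμ T hT N hN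
  obtain ⟨δ₀, η, C, k, hδ₀, hη, hη4, φ, h₀, hφm, hh₀m, hR1, hR2, hR3, hR4⟩ :=
    hR ω₂ lam β γ hω₂ hlam hβ hγ hU μ hμ T hT N hN
  set P := pinnedChain ω₂ lam β γ with hP
  set μT := P.gibbsMeasure N T with hμT
  haveI hprob : IsProbabilityMeasure μT :=
    pinnedChain_isProbabilityMeasure_gibbsMeasure hω₂ hlam.le hβ.le γ N hT
  have hH0 : ∀ x, 0 ≤ P.hamiltonian N x := pinnedChain_hamiltonian_nonneg hω₂.le hlam.le hβ.le γ N
  have hHm : Measurable (P.hamiltonian N) := (pinnedChain_continuous_hamiltonian ω₂ lam β γ N).measurable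
  have hHflip : ∀ x : PhaseSpace N, P.hamiltonian N (x.1, -x.2) = P.hamiltonian N x :=
    P.hamiltonian_neg_momentum N
  have hηT : η < 1 / T := hη4.trans_le (one_div_le_one_div_of_le hT (by linarith))
  have h2η : 2 * η < 1 / T := by
    have h4 : 1 / (4 * T) = (1 / T) / 4 := by rw [div_div, mul_comm]
    have hT1 : 0 < 1 / T := by positivity
    rw [h4] at hη4
    linarith
  have hC : 0 ≤ C := by
    have hx := hR3 (δ₀ / 2) (by rw [abs_of_pos (by positivity)]; linarith) (0 : PhaseSpace N)
    have hpos : 0 < |δ₀ / 2| * (1 + P.hamiltonian N 0) ^ k := by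
      have := hH0 (0 : PhaseSpace N)
      positivity
    have h0 : 0 * (|δ₀ / 2| * (1 + P.hamiltonian N 0) ^ k) ≤ C * (|δ₀ / 2| * (1 + P.hamiltonian N 0) ^ k) := by
      rw [zero_mul, ← mul_assoc]
      exact (abs_nonneg _).trans hx
    exact le_of_mul_le_mul_right h0 hpos
  -- constants
  set θ : ℝ := (1 / T - η) / 2 with hθdef
  have hθ : 0 < θ := by rw [hθdef]; linarith
  have hθη : θ + η < 1 / T := by rw [hθdef]; linarith
  set δ₁ : ℝ := min δ₀ T with hδ₁
  have hδ₁pos : 0 < δ₁ := lt_min hδ₀ hT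
  have hδ₁le : δ₁ ≤ δ₀ := min_le_left _ _
  have hδ₁T : δ₁ ≤ T := min_le_right _ _
  have hIexp := pinnedChain_integrable_exp_mul_hamiltonian_gibbsMeasure hω₂ hlam.le hβ.le γ N hT hθη
  set C₁ : ℝ := exp η * ∫ x, exp ((θ + η) * P.hamiltonian N x) ∂μT with hC₁
  -- the tilted representation on the shrunk range
  have hrep : ∀ δ : ℝ, δ ≠ 0 → |δ| < δ₁ →
      Integrable (fun x => exp (φ δ x)) μT ∧ ∫ x, exp (φ δ x) ∂μT = 1 ∧
        μ N (T + δ / 2) (T - δ / 2) = μT.tilted (φ δ) := by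
    intro δ hδ hδa
    have hδT : |δ| < T := hδa.trans_le hδ₁T
    have h1 : 0 < T + δ / 2 := by linarith [neg_abs_le δ]
    have h2 : 0 < T - δ / 2 := by linarith [le_abs_self δ]
    haveI : IsProbabilityMeasure (μ N (T + δ / 2) (T - δ / 2)) := (hμ N _ _ h1 h2).1
    exact tilted_of_withDensity_exp (hφm δ) (hR1 δ hδ (hδa.trans_le hδ₁le))
  refine ⟨δ₁, θ, 0, C₁, 2 * η, C, 1, k, hδ₁pos, hθ, by linarith, φ, h₀, hφm, ?_, ?_, ?_, ?_, ?_⟩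
  · -- (W0)
    intro δ hδ hδa
    exact hR1 δ hδ (hδa.trans_le hδ₁le)
  · -- (T1)
    intro δ hδ hδa
    obtain ⟨hi, hz1, htilt⟩ := hrep δ hδ hδa
    have hR2δ := hR2 δ (hδa.trans_le hδ₁le)
    have hdom : ∀ x, exp (φ δ x) * exp (θ * P.hamiltonian N x) ≤
        exp η * exp ((θ + η) * P.hamiltonian N x) := by
      intro x
      have hφle : φ δ x ≤ η * (1 + P.hamiltonian N x) := (le_abs_self _).trans (hR2δ x)
      rw [← exp_add, ← exp_add]
      exact exp_le_exp.2 (by nlinarith [hφle])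
    have hInt : Integrable (fun x => exp (φ δ x) * exp (θ * P.hamiltonian N x)) μT := by
      refine (hIexp.const_mul (exp η)).mono' ((hφm δ).exp.mul (hHm.const_mul θ).exp).aestronglyMeasurable
        (ae_of_all _ fun x => ?_)
      rw [Real.norm_eq_abs, abs_of_nonneg (by positivity)]
      exact hdom x
    rw [htilt, integrable_tilted_iff hi, integral_tilted]
    refine ⟨hInt.congr (ae_of_all _ fun x => by simp only [smul_eq_mul]), ?_⟩
    calc ∫ x, (exp (φ δ x) / ∫ x, exp (φ δ x) ∂μT) • exp (θ * P.hamiltonian N x) ∂μT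
        = ∫ x, exp (φ δ x) * exp (θ * P.hamiltonian N x) ∂μT := by
          refine integral_congr_ae (ae_of_all _ fun x => ?_)
          simp only [hz1, div_one, smul_eq_mul]
      _ ≤ ∫ x, exp η * exp ((θ + η) * P.hamiltonian N x) ∂μT := integral_mono hInt (hIexp.const_mul _) hdom
      _ = C₁ := by rw [integral_const_mul]
  · -- (T2o): the crude odd bound from (R2)
    intro δ hδa x
    have h1 := hR2 δ (hδa.trans_le hδ₁le) x
    have h2 := hR2 δ (hδa.trans_le hδ₁le) (x.1, -x.2)
    rw [hHflip] at h2
    calc |φ δ x - φ δ (x.1, -x.2)| ≤ |φ δ x| + |φ δ (x.1, -x.2)| := abs_sub _ _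
      _ ≤ 2 * η * (1 + P.hamiltonian N x) ^ 1 := by rw [pow_one]; linarith
  · -- (B1w) from (R3) and `1 + φ ≤ e^{φ}`
    intro δ hδa x
    have h1 := (abs_le.1 (hR3 δ (hδa.trans_le hδ₁le) x)).1
    have h2 := add_one_le_exp (φ δ x)
    rw [zero_mul, exp_zero, mul_one]
    linarith
  · -- (B2) with `g₀ = h₀`
    have hbound0 : ∀ x, |h₀ x| ≤ C * (1 + P.hamiltonian N x) ^ k := by
      intro x
      refine le_of_tendsto (hR4 x).abs ?_
      filter_upwards [eventually_ne_and_abs_lt hδ₀] with δ hδ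
      rw [abs_div, div_le_iff₀ (abs_pos.2 hδ.1)]
      calc |φ δ x| ≤ C * |δ| * (1 + P.hamiltonian N x) ^ k := hR3 δ hδ.2 x
        _ = C * (1 + P.hamiltonian N x) ^ k * |δ| := by ring
    have hIk : Integrable (fun x => (1 + P.hamiltonian N x) ^ (2 * k)) μT := by
      have h := integrable_one_add_pow_mul_exp_gibbs hω₂ hlam.le hβ.le γ N (2 * k) hT (s := 0)
        (by positivity)
      refine h.congr (ae_of_all _ fun x => ?_)
      simp only [zero_mul, exp_zero, mul_one, hP]
    have hIk2 : Integrable (fun x => (1 + P.hamiltonian N x) ^ (2 * k) *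
        exp (2 * η * P.hamiltonian N x)) μT :=
      integrable_one_add_pow_mul_exp_gibbs hω₂ hlam.le hβ.le γ N (2 * k) hT h2η
    have hh₀2 : MemLp h₀ 2 μT := by
      rw [memLp_two_iff_integrable_sq hh₀m.aestronglyMeasurable]
      refine (hIk.const_mul (C ^ 2)).mono' (hh₀m.pow_const 2).aestronglyMeasurable (ae_of_all _ fun x => ?_)
      rw [Real.norm_eq_abs, abs_of_nonneg (sq_nonneg _), ← sq_abs, pow_mul']
      calc |h₀ x| ^ 2 ≤ (C * (1 + P.hamiltonian N x) ^ k) ^ 2 :=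
            pow_le_pow_left₀ (abs_nonneg _) (hbound0 x) 2
        _ = C ^ 2 * ((1 + P.hamiltonian N x) ^ k) ^ 2 := by ring
    -- pointwise bound on `q_δ = (e^{φ_δ} − 1)/δ`
    have hqbd : ∀ δ : ℝ, δ ≠ 0 → |δ| < δ₀ → ∀ x,
        |(exp (φ δ x) - 1) / δ| ≤ C * (1 + P.hamiltonian N x) ^ k * (exp η * exp (η * P.hamiltonian N x)) := by
      intro δ hδ hδa x
      have h1 := abs_exp_sub_one_le_abs_mul_exp_abs (φ δ x)
      have h2 := hR2 δ hδa x
      have h3 := hR3 δ hδa x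
      have hδp := abs_pos.2 hδ
      rw [abs_div, div_le_iff₀ hδp]
      have h4 : exp |φ δ x| ≤ exp η * exp (η * P.hamiltonian N x) := by
        rw [← exp_add]
        exact exp_le_exp.2 (by linarith)
      calc |exp (φ δ x) - 1| ≤ |φ δ x| * exp |φ δ x| := h1
        _ ≤ (C * |δ| * (1 + P.hamiltonian N x) ^ k) * (exp η * exp (η * P.hamiltonian N x)) :=
            mul_le_mul h3 h4 (exp_pos _).le (by have := hH0 x; positivity)
        _ = C * (1 + P.hamiltonian N x) ^ k * (exp η * exp (η * P.hamiltonian N x)) * |δ| := by ring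
    have hqm : ∀ δ, Measurable fun x => (exp (φ δ x) - 1) / δ := fun δ =>
      ((hφm δ).exp.sub measurable_const).div_const δ
    -- the dominating function
    set bound : PhaseSpace N → ℝ := fun x =>
      2 * (C ^ 2 * exp η ^ 2 * ((1 + P.hamiltonian N x) ^ (2 * k) * exp (2 * η * P.hamiltonian N x))) +
        2 * (C ^ 2 * (1 + P.hamiltonian N x) ^ (2 * k)) with hbound
    have hIbound : Integrable bound μT := ((hIk2.const_mul _).const_mul 2).add ((hIk.const_mul _).const_mul 2)
    have hq2 : ∀ δ : ℝ, δ ≠ 0 → |δ| < δ₀ → ∀ x,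
        ((exp (φ δ x) - 1) / δ) ^ 2 ≤
          C ^ 2 * exp η ^ 2 * ((1 + P.hamiltonian N x) ^ (2 * k) * exp (2 * η * P.hamiltonian N x)) := by
      intro δ hδ hδa x
      have h := hqbd δ hδ hδa x
      have e : C ^ 2 * exp η ^ 2 * ((1 + P.hamiltonian N x) ^ (2 * k) * exp (2 * η * P.hamiltonian N x)) =
          (C * (1 + P.hamiltonian N x) ^ k * (exp η * exp (η * P.hamiltonian N x))) ^ 2 := by
        have e2 : exp (2 * η * P.hamiltonian N x) = exp (η * P.hamiltonian N x) ^ 2 := by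
          rw [← exp_nat_mul]; ring_nf
        rw [e2, pow_mul']
        ring
      rw [e, ← sq_abs]
      exact pow_le_pow_left₀ (abs_nonneg _) h 2
    have hqL2 : ∀ δ : ℝ, δ ≠ 0 → |δ| < δ₀ → MemLp (fun x => (exp (φ δ x) - 1) / δ) 2 μT := by
      intro δ hδ hδa
      rw [memLp_two_iff_integrable_sq (hqm δ).aestronglyMeasurable]
      refine (hIk2.const_mul (C ^ 2 * exp η ^ 2)).mono' ((hqm δ).pow_const 2).aestronglyMeasurable
        (ae_of_all _ fun x => ?_)
      rw [Real.norm_eq_abs, abs_of_nonneg (sq_nonneg _)]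
      exact hq2 δ hδ hδa x
    refine ⟨hh₀2, fun δ hδ hδa => hqL2 δ hδ (hδa.trans_le hδ₁le), ?_⟩
    -- dominated convergence
    have hlim0 : Tendsto (fun δ : ℝ => ∫ x, ((exp (φ δ x) - 1) / δ - h₀ x) ^ 2 ∂μT) (𝓝[≠] (0 : ℝ))
        (𝓝 (∫ x, (fun _ => (0 : ℝ)) x ∂μT)) := by
      refine tendsto_integral_filter_of_dominated_convergence bound ?_ ?_ hIbound ?_
      · exact Eventually.of_forall fun δ => (((hqm δ).sub hh₀m).pow_const 2).aestronglyMeasurable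
      · filter_upwards [eventually_ne_and_abs_lt hδ₀] with δ hδ
        refine ae_of_all _ fun x => ?_
        rw [Real.norm_eq_abs, abs_of_nonneg (sq_nonneg _), hbound]
        have h1 := hq2 δ hδ.1 hδ.2 x
        have h2 : h₀ x ^ 2 ≤ C ^ 2 * (1 + P.hamiltonian N x) ^ (2 * k) := by
          rw [← sq_abs, pow_mul']
          calc |h₀ x| ^ 2 ≤ (C * (1 + P.hamiltonian N x) ^ k) ^ 2 :=
                pow_le_pow_left₀ (abs_nonneg _) (hbound0 x) 2
            _ = C ^ 2 * ((1 + P.hamiltonian N x) ^ k) ^ 2 := by ring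
        nlinarith [sq_nonneg ((exp (φ δ x) - 1) / δ + h₀ x), h1, h2]
      · refine ae_of_all _ fun x => ?_
        have hu : Tendsto (fun δ : ℝ => φ δ x) (𝓝[≠] (0 : ℝ)) (𝓝 0) := by
          refine squeeze_zero_norm' ?_ ?_ (a := fun δ : ℝ => C * (1 + P.hamiltonian N x) ^ k * |δ|)
          · filter_upwards [eventually_ne_and_abs_lt hδ₀] with δ hδ
            rw [Real.norm_eq_abs]
            calc |φ δ x| ≤ C * |δ| * (1 + P.hamiltonian N x) ^ k := hR3 δ hδ.2 x
              _ = C * (1 + P.hamiltonian N x) ^ k * |δ| := by ring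
          · have h : Tendsto (fun δ : ℝ => |δ|) (𝓝[≠] (0 : ℝ)) (𝓝 0) := by
              have h0 := (continuous_abs.tendsto (0 : ℝ))
              rw [abs_zero] at h0
              exact h0.mono_left nhdsWithin_le_nhds
            have h2 := h.const_mul (C * (1 + P.hamiltonian N x) ^ k)
            rw [mul_zero] at h2
            exact h2
        have hq := tendsto_exp_sub_one_div hu (hR4 x)
        have h := (hq.sub_const (h₀ x)).pow 2
        rw [sub_self, zero_pow two_ne_zero] at h
        exact h
    rw [integral_zero] at hlim0
    exact hlim0

/-- **`(R) ⟹ K_fix`** through the energy window (composition; cf. the tree's route of record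
`stub_snapshotKLUpper_of_density ∘ stub_oddLogDensity_of_regularity`). [folklore] -/
theorem snapshotKLUpperExpansion_of_logDensityRegularity (hR : LogDensityRegularity) :
    SnapshotKLUpperExpansion :=
  snapshotKLUpperExpansion_of_energyWindow (energyWindowControl_of_logDensityRegularity hR)

end Summit.AtomisticToContinuum.FouriersLaw.Theorems.ExtensiveSnapshotIrreversibility.EnergyWindow

end
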